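import Summits.BirchSwinnertonDyer.BirchSwinnertonDyer.Theorems.PrintCf2SplitBadTwoNormAtVbarTwistedValuation
import HarnessLib

/-!
# Crux `PrintCf2.SplitBadTwoRankOneOfFacts` (stmt-BirchSwinnertonDyer-20368), skeleton v13.5, (REG₂) `stub_xRegular_two` FACT-FREE road, R2 brick
# **B5-T-loc (FILE 7): GLUE** — `D_v̄ ≤ H ⊴ Γ_K ⟹ I_𝔓 ≤ H` for all `𝔓 ∣ v̄`, and FILE 6 §4 with its `hIZ` hypothesis discharged for normal `Gal(K̄/Z)`

Cell `bsd-print-cf2`, EXTRA WIDTH seat `bsd-line-cf2-p1-w3` g14 (prover-bsd-line-cf2-p1-w3-g14-0); `--supports stmt-BirchSwinnertonDyer-20368`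
(helper, Theses-free). HONEST FRAMING: nothing here closes the crux or a registered stub; BSD is not proved by any of this; no summit
statement is proved by this seat. No definition, no named fact, no `sorry`. UNCONDITIONAL.

WHAT. `forall_inertia_le_of_forall_absGaloisRestrict_mem` (the hypothesis `hIZ` of FILE 6 from `hDZ` alone when `H = Gal(K̄/Z)` is normal, e.g.
`Z = K_ε`, `H = ker ε`); `mul_ramificationIdx_dvd_log_valuation_of_coe_mem_of_normal` = FILE 6 §4 `mul_ramificationIdx_dvd_log_valuation_of_coe_mem`
with `hIZ` discharged (binder `[(galFixing K Z).Normal]` instead). For -w4 g14's assembler T4 (STATUS 08:38:15Z). presearch: Neukirch ANT I (9.4) (conjugate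
primes have conjugate inertia groups); folklore. beyond-print theorem: no.

References: [NeukirchANT1999] Ch. I §9 (9.4), (9.6), Ch. II §9.
-/

open scoped Classical Pointwise WithZero ContRepresentation NumberField
open NumberField IsDedekindDomain Field Function
open _root_.ContinuousCohomology
open Literature.NumberTheory.GaloisRepresentations
open Literature.NumberTheory.GaloisRepresentations.DiscreteGaloisModule
open Literature.NumberTheory.GaloisRepresentations.LocalWeilDatum
open Literature.NumberTheory.GaloisCohomology
open Literature.NumberTheory.EllipticCurves

set_option linter.dupNamespace false
set_option autoImplicit false

namespace Summit.BirchSwinnertonDyer.BirchSwinnertonDyer.Theorems.PrintCf2.NormAtVbar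

section Glue

variable (K : Type) [Field K] [NumberField K]

/-- **`D_v̄ ≤ H` with `H` normal ⟹ every inertia group above `v̄` lies in `H`.** `I_{𝔓₀} ≤ D_{𝔓₀} = res(Γ_{K_v̄})`
(`Ideal.inertia_le_decompositionSubgroup`, `decompositionSubgroup_adicCompletionPrime_eq_range`); every `𝔓 ∣ v̄` is `g • 𝔓₀`
(`exists_smul_eq_of_mem_primesAbove_holds`) with `I_{g𝔓₀} = g I_{𝔓₀} g⁻¹` (`KummerU.mem_inertia_pointwise_smul_iff`); `H` is normal. This discharges the
hypothesis `hIZ` of FILE 6 (`…NormAtVbarTwistedValuation`) for `Z = K_ε` (`galFixing K K_ε = ker ε ⊇ D_v̄` in the split case).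
[cite: NeukirchANT1999, Ch. I §9 (9.4), (9.6)] -/
theorem forall_inertia_le_of_forall_absGaloisRestrict_mem (vbar : HeightOneSpectrum (𝓞 K)) (H : Subgroup (absoluteGaloisGroup K)) [H.Normal]
    (hD : ∀ σ : absoluteGaloisGroup (vbar.adicCompletion K), absGaloisRestrict K (vbar.adicCompletion K) σ ∈ H) :
    ∀ 𝔓 ∈ vbar.primesAbove, 𝔓.inertia (absoluteGaloisGroup K) ≤ H := by
  intro 𝔓 h𝔓 τ hτ
  obtain ⟨g, hg⟩ := HeightOneSpectrum.exists_smul_eq_of_mem_primesAbove_holds (K := K) (v := vbar)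
    (adicCompletionPrime_mem_primesAbove K vbar) h𝔓
  rw [← hg, KummerU.mem_inertia_pointwise_smul_iff] at hτ
  have h0 : g⁻¹ * τ * g ∈ H := by
    have h := Ideal.inertia_le_decompositionSubgroup (G := absoluteGaloisGroup K) (𝔓 := adicCompletionPrime K vbar) hτ
    rw [decompositionSubgroup_adicCompletionPrime_eq_range] at h
    obtain ⟨σ, hσ⟩ := h
    rw [← hσ]
    exact hD σ
  have h1 : g * (g⁻¹ * τ * g) * g⁻¹ ∈ H := ‹H.Normal›.conj_mem _ h0 g
  have h2 : g * (g⁻¹ * τ * g) * g⁻¹ = τ := by group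
  rwa [h2] at h1

/-- **FILE 6 §4 with `hIZ` discharged.** For a finite Galois `Z ⊆ K̄` with NORMAL `Gal(K̄/Z)` containing `res(Γ_{K_v̄})`, a finite `Z′ ⊇ Z`,
the place `w′` of `Z′` below `𝔓₀`, `z′ ∈ Z′` with `↑z′ ∈ Z`, an `n`-th root `ζ` of `z′`, a `1`-cocycle `φ` of `Γ_K` in `(ℤ/n)^D` (`ρ` trivial on
`res(Γ_{K_v̄})`) with `loc_v̄[φ] ⟂ H¹_ur` and `muVal(φ(g)(1)) = g ζ / ζ` on `Gal(K̄/Z)`: `n · e(w′∣v̄) ∣ log (w′.valuation Z′ z′)`.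
[cite: NeukirchANT1999, Ch. I §9 (9.4), Ch. II §9 (9.6)] [cite: SerreLocalFields1979, Ch. XIV §1 Prop. 3] -/
theorem mul_ramificationIdx_dvd_log_valuation_of_coe_mem_of_normal {n : ℕ} [NeZero n] (ρ : DiscreteGaloisModule K (ZMod n))
    (vbar : HeightOneSpectrum (𝓞 K))
    (hloc : ∀ (σ : absoluteGaloisGroup (vbar.adicCompletion K)) (m : ZMod n), ρ (absGaloisRestrict K (vbar.adicCompletion K) σ) m = m)
    (φY : contOneCocycles ((ρ.tateDual n).toTopRep))
    (hY : galoisCohomology.localization (ρ.tateDual n) (Sum.inr vbar) 1 (oneCocycleClass _ φY) ∈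
      (LocalInvariants.canonical K n).dualLocalCondition ρ (Sum.inr vbar) (unramifiedSubgroup (GaloisRep.toLocal vbar ρ) 1))
    (Z : IntermediateField K (AlgebraicClosure K)) [FiniteDimensional K Z] [IsGalois K Z] [NumberField Z] [(galFixing K Z).Normal]
    (hDZ : ∀ σ : absoluteGaloisGroup (vbar.adicCompletion K), absGaloisRestrict K (vbar.adicCompletion K) σ ∈ galFixing K Z)
    (Z' : IntermediateField K (AlgebraicClosure K)) [FiniteDimensional K Z'] [NumberField Z'] (hle : Z ≤ Z')
    (w' : HeightOneSpectrum (𝓞 Z'))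
    (hw' : (adicCompletionPrime K vbar).comap (ringOfIntegersToIntegralClosure (k := K) (Ω := AlgebraicClosure K) Z') = w'.asIdeal)
    (z' : Z') (hz' : (z' : AlgebraicClosure K) ∈ Z)
    (ζ : (AlgebraicClosure K)ˣ) (hζ : ((ζ ^ n : (AlgebraicClosure K)ˣ) : AlgebraicClosure K) = (z' : AlgebraicClosure K))
    (hread : ∀ g ∈ galFixing K Z, muVal K n ((φY.1 g) 1) = g • ζ / ζ) :
    ((n : ℤ) * (vbar.asIdeal.ramificationIdx' w'.asIdeal : ℕ)) ∣ WithZero.log (w'.valuation Z' z') :=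
  mul_ramificationIdx_dvd_log_valuation_of_coe_mem K ρ vbar hloc φY hY Z hDZ
    (forall_inertia_le_of_forall_absGaloisRestrict_mem K vbar (galFixing K Z) hDZ) Z' hle w' hw' z' hz' ζ hζ hread

end Glue

end Summit.BirchSwinnertonDyer.BirchSwinnertonDyer.Theorems.PrintCf2.NormAtVbar
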